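import Literature.MathematicalPhysics.QuantumFieldTheory.Balaban1983to89.B6Eq2117FaddeevPopov
import Literature.MathematicalPhysics.QuantumFieldTheory.Balaban1983to89.B6Repr2129

/-!
# `Balaban1983to89.B6Eq2129FaddeevPopov` — T. Bałaban, *Propagators and renormalization transformations for lattice
# gauge theories. II*, Commun. Math. Phys. **96** (1984) 223–250 [Balaban1984PropagatorsII], Sect. C (2.116)–(2.119)
# p. 243 and (2.129)–(2.130) p. 246: the identification *"the quadratic forms are equal to ⟨B, Δ_jB⟩"* in MEASURE-FREE
# form (the Faddeev–Popov/Gaussian route of `…B6Eq2117FaddeevPopov` run internally), and (2.119), (2.129) RESTATED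
# WITHOUT the hypothesis `h2118` — it is replaced by the printed δ-gauge data of [4] Sect. D

statement-level skeleton of published theorems with citation tags; proofs where landed; nothing here is a claim about the Yang–Mills mass gap

PDF held: `paper:balaban1984-cmp96-propagators-rt-ii` (journal page = PDF page + 222); pp. 243, 246 read AS IMAGES on the
×2 renders `run/shared/lean/pub/pub-balaban/b2b-balaban-ref1/pages/1984-cmp96-propagators-rt-II/…-p021, -p024-x2.png` and,
for [4] = [Balaban1984PropagatorsI] pp. 26, 29, `…/1984-cmp95-propagators-rt-I/…-p010, -p013-x2.png`, by this seat
(2026-08-21).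

CITATION HEADER (lean-in-tree rule).  WHAT IS REPRODUCED: rows **B6.Eq2.111** (member (2.116)–(2.118)), **B6.Eq2.119**
and **B6.Eq2.129** of the lit-balaban SKELETON — the assembly step that removes the located hypothesis
`h2118 : ⟨H_jB,(Δ−∂P_j∂*)H_jB⟩ = ⟨B,Δ_jB⟩` from `…B6GaussianIdentity2119.eq2119` (seat p22 gen 1) and
`…B6Repr2129.eq2129` / `eq2129_printed` (gen 2), using `…B6Eq2117FaddeevPopov.forms_eq_of_fp` / `Ztilde_pos` (gen 5).
PHASE-2 seat p22 (gen 5), companion of `…B6Eq2117FaddeevPopov`; owner r03, referee ref-4.  IMPORTS, restating nothing: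
`…B6Eq2117FaddeevPopov`, `…B6Repr2129` (→ `…B6GaussianIdentity2119`, `…B6Eq2130`).

PRINT (p. 243 [PDF 21], verbatim).  *"The operator H_j may be different from the operator defined in Sect. D of [4], because
there is the exponential gauge fixing term instead of the δ-function, but we will prove later that they are equal. … in the
last integral we may replace the exponential gauge fixing term by the δ-function δ_R(R∂*A) using the Faddeev-Popov
procedure. Then this integral gives the factor exp[−½‖∂H_jB‖²] (2.117) by (1.47) and (1.64). Thus both factors are equal
and in fact the quadratic forms are equal to ⟨B, Δ_jB⟩ given by (1.66) and satisfying (1.67): γ₀‖∂₁B‖² ≦ ⟨B,Δ_jB⟩ ≦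
γ₁‖∂₁B‖². (2.118) These calculations give [(2.119)]"*; p. 246 [PDF 24]: *"We may calculate the integral in (2.119), and
we get finally the desired identity [(2.129)] … we get the formula H_j = G_jQ_j*(Q_jG_jQ_j*)⁻¹. (2.130) Thus this operator
coincides with the operator introduced in Sect. D."*  [4] p. 29: *"Q_kH_kB = B, R∂*H_kB = 0, H_kB is a minimum of
½⟨∂A,∂A⟩ on the hyperplane {A : Q_kA = B, R∂*A = 0}, which means that ⟨∂A′,∂H_kB⟩ = 0 on the subspace {A′ : Q_kA′ = 0,
R∂*A′ = 0} … ⟨B,Δ_kB⟩ = ⟨∂H_kB,∂H_kB⟩. (1.65)"*.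

WHAT IS PROVED (all theorems; no definitions; standard axioms; conventions of `…B6Eq2117FaddeevPopov`: `M` = Δ − ∂P_j∂*
with `⟨A,MA⟩ = ‖∂A‖² + ⟨∂*A,R∂*A⟩`, `R` the orthogonal projection onto `ΔN(Q′) = range D`, gauge group `N(Q′)` acting by
`A ↦ A − ∂λ` with `∂∂λ = 0`, `Q_j∂λ = 0`, `∂*∂λ = Δλ`, Δ injective on `N(Q′)`; `H_j^{δ}B` = a configuration with
`Q_jH_j^{δ}B = Q_jH_j^{exp}B`, `R∂*H_j^{δ}B = 0` and the p. 29 orthogonality).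
§1 **`forms_eq_of_pos`** — `⟨H_j^{exp}B,(Δ−∂P_j∂*)H_j^{exp}B⟩ = ‖∂H_j^{δ}B‖²` from the PRINTED STRUCTURE and POSITIVITY
   of the form on `{Q_jA = 0}` alone ((2.118)/[4] (1.67) make it positive): the Lebesgue measure of the fibre and `Z̃_j > 0`
   are produced inside the proof (`Measure.addHaar`, `…B6Eq2117FaddeevPopov.Ztilde_pos`), so no measure appears in the
   statement; `dGauge_eq_expGauge_of_pos` (*"we will prove later that they are equal"*: `H_j^{δ}B = H_j^{exp}B`);
   `h2118_of_pos` (operators: `∀ B, ⟨H_j^{exp}B, MH_j^{exp}B⟩ = ⟨B,Δ_jB⟩` for `Δ_j` with `⟨B,Δ_jB⟩ = ‖∂H_j^{δ}B‖²`, (1.65));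
   `hOp_form_eq` / `dGauge_eq_hOp` — the same for THE printed `H_j = G_jQ_j*(Q_jG_jQ_j*)⁻¹` of (2.130)
   (`…B6SectA.hOp`, its `hcrit` being `…B6Eq2130.hOp_crit`): *"Thus this operator coincides with the operator
   introduced in Sect. D"* by the Gaussian route (the algebraic route is `…B6Eq2130.minimisers_coincide`).
§2 **`eq2119_fp`** = `…B6GaussianIdentity2119.eq2119` and **`eq2129_printed_fp`** = `…B6Repr2129.eq2129_printed` with
   `h2118` REPLACED by the δ-gauge data (every other hypothesis unchanged, conclusions verbatim).
HONEST SCOPE: abstract carriers as in the sibling files; the positivity constant `γ` is a hypothesis ((2.118) = [4] (1.67)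
is `…B5.Bounds167`, not re-derived here); value = kernel certificate of the displayed computation, NOT summit progress.
Unit `lit-balaban-p22` (gen 5), HOME `run/shared/lean/pub/lit-balaban/`.
-/

noncomputable section

open MeasureTheory
open scoped InnerProductSpace

namespace Literature.MathematicalPhysics.QuantumFieldTheory.Balaban1983to89.B6Eq2129FaddeevPopov

open B6Eq2117FaddeevPopov

/-! ## §1  The identification of the quadratic forms, measure-free -/

section MeasureFree

variable {V A W T N : Type*} [NormedAddCommGroup V] [InnerProductSpace ℝ V]
  [NormedAddCommGroup A] [InnerProductSpace ℝ A] [FiniteDimensional ℝ A]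
  [NormedAddCommGroup W] [InnerProductSpace ℝ W] [NormedAddCommGroup T] [InnerProductSpace ℝ T]
  [NormedAddCommGroup N] [NormedSpace ℝ N] [FiniteDimensional ℝ N]

/-- **"Thus both factors are equal and in fact the quadratic forms are equal"** (p. 243), MEASURE-FREE: if the form
`⟨A,(Δ−∂P_j∂*)A⟩ = ‖∂A‖² + ⟨∂*A,R∂*A⟩` is positive on `{Q_jA = 0}` (`γ > 0`), then for the critical configuration
`hε = H_j^{exp}B` of the exponential gauge fixing (`(Δ−∂P_j∂*)hε ⊥ {Q_jA = 0}`) and the δ-gauge configuration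
`hδ = H_j^{δ}B` of [4] Sect. D on the same fibre (`R∂*hδ = 0`, `∂hδ ⊥ ∂{Q_j· = 0, R∂*· = 0}`):
`⟨hε,(Δ−∂P_j∂*)hε⟩ = ‖∂hδ‖²`.  Proof = the Faddeev–Popov/Gaussian route of `…B6Eq2117FaddeevPopov.forms_eq_of_fp` with
the Lebesgue measure of the fibre and `Z̃_j > 0` (`Ztilde_pos`) supplied internally.
[cite: Balaban1984PropagatorsII, (2.117)–(2.118) p.243] -/
theorem forms_eq_of_pos (Q : A →ₗ[ℝ] W) (M : A →ₗ[ℝ] A) (curl : A →ₗ[ℝ] T) (dstar : A →ₗ[ℝ] V)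
    (Rp : V →ₗ[ℝ] V) (D : N →ₗ[ℝ] V) (dN : N →ₗ[ℝ] A) (K : Submodule ℝ V) [K.HasOrthogonalProjection]
    (hK : LinearMap.range D = K) (hR : ∀ g, Rp g = K.starProjection g)
    (hM : ∀ x y : A, ⟪M x, y⟫_ℝ = ⟪x, M y⟫_ℝ)
    (hformM : ∀ v, ⟪v, M v⟫_ℝ = ‖curl v‖ ^ 2 + ⟪dstar v, Rp (dstar v)⟫_ℝ)
    (hcurl : ∀ l, curl (dN l) = 0) (hQ : ∀ l, Q (dN l) = 0) (hD : ∀ l, dstar (dN l) = D l)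
    (hDinj : Function.Injective D) {γ : ℝ} (hγ : 0 < γ)
    (hpos : ∀ v : A, Q v = 0 → γ * ‖v‖ ^ 2 ≤ ⟪v, M v⟫_ℝ) {hε hδ : A} (hQh : Q hδ = Q hε)
    (hcritε : ∀ v : A, Q v = 0 → ⟪v, M hε⟫_ℝ = 0) (hδR : Rp (dstar hδ) = 0)
    (hcritδ : ∀ v : A, Q v = 0 → Rp (dstar v) = 0 → ⟪curl v, curl hδ⟫_ℝ = 0) :
    ⟪hε, M hε⟫_ℝ = ‖curl hδ‖ ^ 2 := by
  borelize A
  exact forms_eq_of_fp Q Measure.addHaar M curl dstar Rp D dN K hK hR hM hformM hcurl hQ hD hDinj hQh hcritε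
    hδR hcritδ (Ztilde_pos Q Measure.addHaar M hγ hpos).ne'

omit [FiniteDimensional ℝ A] in
/-- Positivity of the form on `{Q_jA = 0}` gives definiteness there (the `hdef` of `…B6Eq2117FaddeevPopov.translations_eq`
and `…B6Eq2130.hOp_unique`). [cite: Balaban1984PropagatorsII, (2.118) p.243] -/
theorem hdef_of_pos (Q : A →ₗ[ℝ] W) (M : A →ₗ[ℝ] A) {γ : ℝ} (hγ : 0 < γ)
    (hpos : ∀ v : A, Q v = 0 → γ * ‖v‖ ^ 2 ≤ ⟪v, M v⟫_ℝ) (v : A) (hv : Q v = 0) (h0 : ⟪v, M v⟫_ℝ = 0) :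
    v = 0 := by
  have h1 : γ * ‖v‖ ^ 2 ≤ 0 := h0 ▸ hpos v hv
  have h2 : ‖v‖ ^ 2 ≤ 0 := by
    by_contra h
    have h' : 0 < ‖v‖ ^ 2 := lt_of_not_ge h
    have := mul_pos hγ h'
    linarith
  have h3 : ‖v‖ = 0 := by nlinarith [norm_nonneg v]
  exact norm_eq_zero.mp h3

/-- **"… but we will prove later that they are equal"** (p. 243), measure-free: under positivity of the form on
`{Q_jA = 0}`, the δ-gauge configuration `H_j^{δ}B` of [4] Sect. D IS the critical configuration `H_j^{exp}B` of the
exponential gauge fixing on the same fibre. [cite: Balaban1984PropagatorsII, (2.113)–(2.118) p.243] -/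
theorem dGauge_eq_expGauge_of_pos (Q : A →ₗ[ℝ] W) (M : A →ₗ[ℝ] A) (curl : A →ₗ[ℝ] T) (dstar : A →ₗ[ℝ] V)
    (Rp : V →ₗ[ℝ] V) (D : N →ₗ[ℝ] V) (dN : N →ₗ[ℝ] A) (K : Submodule ℝ V) [K.HasOrthogonalProjection]
    (hK : LinearMap.range D = K) (hR : ∀ g, Rp g = K.starProjection g)
    (hM : ∀ x y : A, ⟪M x, y⟫_ℝ = ⟪x, M y⟫_ℝ)
    (hformM : ∀ v, ⟪v, M v⟫_ℝ = ‖curl v‖ ^ 2 + ⟪dstar v, Rp (dstar v)⟫_ℝ)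
    (hcurl : ∀ l, curl (dN l) = 0) (hQ : ∀ l, Q (dN l) = 0) (hD : ∀ l, dstar (dN l) = D l)
    (hDinj : Function.Injective D) {γ : ℝ} (hγ : 0 < γ)
    (hpos : ∀ v : A, Q v = 0 → γ * ‖v‖ ^ 2 ≤ ⟪v, M v⟫_ℝ) {hε hδ : A} (hQh : Q hδ = Q hε)
    (hcritε : ∀ v : A, Q v = 0 → ⟪v, M hε⟫_ℝ = 0) (hδR : Rp (dstar hδ) = 0)
    (hcritδ : ∀ v : A, Q v = 0 → Rp (dstar v) = 0 → ⟪curl v, curl hδ⟫_ℝ = 0) :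
    hδ = hε :=
  translations_eq M Q curl dstar Rp hM hformM hQh hcritε hδR
    (forms_eq_of_pos Q M curl dstar Rp D dN K hK hR hM hformM hcurl hQ hD hDinj hγ hpos hQh hcritε hδR hcritδ)
    (hdef_of_pos Q M hγ hpos)

/-- **`h2118` measure-free, for operators:** `H_j^{exp}` (`Hε`, `(Δ−∂P_j∂*)H_jB ⊥ {Q_jA = 0}`), `H_j^{δ}` (`Hδ`: same fibre,
`R∂*H_jB = 0`, the p. 29 orthogonality of [4]) and `Δ_j` with `⟨B,Δ_jB⟩ = ‖∂H_j^{δ}B‖²` ([4] (1.65)):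
`∀ B, ⟨H_j^{exp}B,(Δ−∂P_j∂*)H_j^{exp}B⟩ = ⟨B,Δ_jB⟩`. [cite: Balaban1984PropagatorsII, (2.118) p.243] -/
theorem h2118_of_pos {Bs : Type*} [NormedAddCommGroup Bs] [InnerProductSpace ℝ Bs] (Q : A →ₗ[ℝ] W) (M : A →ₗ[ℝ] A) (curl : A →ₗ[ℝ] T) (dstar : A →ₗ[ℝ] V)
    (Rp : V →ₗ[ℝ] V) (D : N →ₗ[ℝ] V) (dN : N →ₗ[ℝ] A) (K : Submodule ℝ V) [K.HasOrthogonalProjection]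
    (hK : LinearMap.range D = K) (hR : ∀ g, Rp g = K.starProjection g)
    (hM : ∀ x y : A, ⟪M x, y⟫_ℝ = ⟪x, M y⟫_ℝ)
    (hformM : ∀ v, ⟪v, M v⟫_ℝ = ‖curl v‖ ^ 2 + ⟪dstar v, Rp (dstar v)⟫_ℝ)
    (hcurl : ∀ l, curl (dN l) = 0) (hQ : ∀ l, Q (dN l) = 0) (hD : ∀ l, dstar (dN l) = D l)
    (hDinj : Function.Injective D) {γ : ℝ} (hγ : 0 < γ)
    (hpos : ∀ v : A, Q v = 0 → γ * ‖v‖ ^ 2 ≤ ⟪v, M v⟫_ℝ)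
    (Hε Hδ : Bs →ₗ[ℝ] A) (Δj : Bs →ₗ[ℝ] Bs) (hQH : ∀ b, Q (Hδ b) = Q (Hε b))
    (hcritε : ∀ (b : Bs) (v : A), Q v = 0 → ⟪v, M (Hε b)⟫_ℝ = 0) (hδR : ∀ b, Rp (dstar (Hδ b)) = 0)
    (hcritδ : ∀ (b : Bs) (v : A), Q v = 0 → Rp (dstar v) = 0 → ⟪curl v, curl (Hδ b)⟫_ℝ = 0)
    (h165 : ∀ b, ⟪b, Δj b⟫_ℝ = ‖curl (Hδ b)‖ ^ 2) (b : Bs) :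
    ⟪Hε b, M (Hε b)⟫_ℝ = ⟪b, Δj b⟫_ℝ := by
  rw [h165]
  exact forms_eq_of_pos Q M curl dstar Rp D dN K hK hR hM hformM hcurl hQ hD hDinj hγ hpos (hQH b) (hcritε b)
    (hδR b) (hcritδ b)

/-- **For THE printed `H_j = G_jQ_j*(Q_jG_jQ_j*)⁻¹` of (2.130)** (`…B6SectA.hOp G_j Q_j* E`; `G_j` a right inverse of
`(Δ−∂P_j∂*) + Q_j*a₁Q_j`, `E` a right inverse of `Q_jG_jQ_j*`, `Q_j*` the adjoint of `Q_j` — its `hcrit` is the theorem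
`…B6Eq2130.hOp_crit`, its `Q_jH_j = I` is `…B6Eq2130.Q_hOp`): `⟨H_jB,(Δ−∂P_j∂*)H_jB⟩ = ‖∂H_j^{δ}B‖²` for the δ-gauge
configuration `H_j^{δ}B` with `Q_jH_j^{δ}B = B`. [cite: Balaban1984PropagatorsII, (2.118) p.243 + (2.130) p.246] -/
theorem hOp_form_eq (Q : A →ₗ[ℝ] W) (M Gj : A →ₗ[ℝ] A) (Qs : W →ₗ[ℝ] A) (a₁ E : W →ₗ[ℝ] W)
    (curl : A →ₗ[ℝ] T) (dstar : A →ₗ[ℝ] V) (Rp : V →ₗ[ℝ] V) (D : N →ₗ[ℝ] V) (dN : N →ₗ[ℝ] A)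
    (K : Submodule ℝ V) [K.HasOrthogonalProjection] (hK : LinearMap.range D = K)
    (hR : ∀ g, Rp g = K.starProjection g) (hM : ∀ x y : A, ⟪M x, y⟫_ℝ = ⟪x, M y⟫_ℝ)
    (hQs : ∀ (w : W) (v : A), ⟪Qs w, v⟫_ℝ = ⟪w, Q v⟫_ℝ)
    (hGj : (M + Qs ∘ₗ a₁ ∘ₗ Q) ∘ₗ Gj = LinearMap.id) (hE : (Q ∘ₗ Gj ∘ₗ Qs) ∘ₗ E = LinearMap.id)
    (hformM : ∀ v, ⟪v, M v⟫_ℝ = ‖curl v‖ ^ 2 + ⟪dstar v, Rp (dstar v)⟫_ℝ)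
    (hcurl : ∀ l, curl (dN l) = 0) (hQ : ∀ l, Q (dN l) = 0) (hD : ∀ l, dstar (dN l) = D l)
    (hDinj : Function.Injective D) {γ : ℝ} (hγ : 0 < γ)
    (hpos : ∀ v : A, Q v = 0 → γ * ‖v‖ ^ 2 ≤ ⟪v, M v⟫_ℝ) (b : W) {hδ : A} (hQδ : Q hδ = b)
    (hδR : Rp (dstar hδ) = 0) (hcritδ : ∀ v : A, Q v = 0 → Rp (dstar v) = 0 → ⟪curl v, curl hδ⟫_ℝ = 0) :
    ⟪B6SectA.hOp Gj Qs E b, M (B6SectA.hOp Gj Qs E b)⟫_ℝ = ‖curl hδ‖ ^ 2 :=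
  forms_eq_of_pos Q M curl dstar Rp D dN K hK hR hM hformM hcurl hQ hD hDinj hγ hpos
    (by rw [hQδ, B6Eq2130.Q_hOp Gj Q Qs E hE b])
    (fun v hv => B6Eq2130.hOp_crit M Gj Q Qs a₁ E hQs hGj hE b v hv) hδR hcritδ

/-- **"Thus this operator coincides with the operator introduced in Sect. D"** (p. 246, after (2.130)) BY THE GAUSSIAN
ROUTE: the δ-gauge configuration of [4] Sect. D on the fibre `{Q_jA = B}` equals `G_jQ_j*(Q_jG_jQ_j*)⁻¹B`, under
positivity of `(Δ−∂P_j∂*)` on `{Q_jA = 0}` (the algebraic route is `…B6Eq2130.minimisers_coincide`).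
[cite: Balaban1984PropagatorsII, (2.130) p.246] -/
theorem dGauge_eq_hOp (Q : A →ₗ[ℝ] W) (M Gj : A →ₗ[ℝ] A) (Qs : W →ₗ[ℝ] A) (a₁ E : W →ₗ[ℝ] W)
    (curl : A →ₗ[ℝ] T) (dstar : A →ₗ[ℝ] V) (Rp : V →ₗ[ℝ] V) (D : N →ₗ[ℝ] V) (dN : N →ₗ[ℝ] A)
    (K : Submodule ℝ V) [K.HasOrthogonalProjection] (hK : LinearMap.range D = K)
    (hR : ∀ g, Rp g = K.starProjection g) (hM : ∀ x y : A, ⟪M x, y⟫_ℝ = ⟪x, M y⟫_ℝ)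
    (hQs : ∀ (w : W) (v : A), ⟪Qs w, v⟫_ℝ = ⟪w, Q v⟫_ℝ)
    (hGj : (M + Qs ∘ₗ a₁ ∘ₗ Q) ∘ₗ Gj = LinearMap.id) (hE : (Q ∘ₗ Gj ∘ₗ Qs) ∘ₗ E = LinearMap.id)
    (hformM : ∀ v, ⟪v, M v⟫_ℝ = ‖curl v‖ ^ 2 + ⟪dstar v, Rp (dstar v)⟫_ℝ)
    (hcurl : ∀ l, curl (dN l) = 0) (hQ : ∀ l, Q (dN l) = 0) (hD : ∀ l, dstar (dN l) = D l)
    (hDinj : Function.Injective D) {γ : ℝ} (hγ : 0 < γ)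
    (hpos : ∀ v : A, Q v = 0 → γ * ‖v‖ ^ 2 ≤ ⟪v, M v⟫_ℝ) (b : W) {hδ : A} (hQδ : Q hδ = b)
    (hδR : Rp (dstar hδ) = 0) (hcritδ : ∀ v : A, Q v = 0 → Rp (dstar v) = 0 → ⟪curl v, curl hδ⟫_ℝ = 0) :
    hδ = B6SectA.hOp Gj Qs E b :=
  dGauge_eq_expGauge_of_pos Q M curl dstar Rp D dN K hK hR hM hformM hcurl hQ hD hDinj hγ hpos
    (by rw [hQδ, B6Eq2130.Q_hOp Gj Q Qs E hE b])
    (fun v hv => B6Eq2130.hOp_crit M Gj Q Qs a₁ E hQs hGj hE b v hv) hδR hcritδ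

end MeasureFree

/-! ## §2  (2.119) and (2.129) without the hypothesis `h2118` -/

section Assembled

variable {A : Type*} [NormedAddCommGroup A] [InnerProductSpace ℝ A] [FiniteDimensional ℝ A]
variable {W : Type*} [NormedAddCommGroup W] [InnerProductSpace ℝ W]
variable {N : Type*} [AddCommGroup N] [Module ℝ N] [MeasurableSpace N] [MeasurableAdd N]
variable {Bs : Type*} [NormedAddCommGroup Bs] [InnerProductSpace ℝ Bs]
variable {V : Type*} [NormedAddCommGroup V] [InnerProductSpace ℝ V]
variable {NB : Type*} [MeasurableSpace NB]
variable {Vs T Ng : Type*} [NormedAddCommGroup Vs] [InnerProductSpace ℝ Vs] [NormedAddCommGroup T]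
  [InnerProductSpace ℝ T] [NormedAddCommGroup Ng] [NormedSpace ℝ Ng] [FiniteDimensional ℝ Ng]

/-- **(2.119) p. 243 AS PRINTED, from (2.112), with the identification (2.116)–(2.118) PROVED rather than assumed:**
`…B6GaussianIdentity2119.eq2119` verbatim, its hypothesis `h2118` replaced by the printed structure of Sect. A/C
(`⟨A,(Δ−∂P_j∂*)A⟩ = ‖∂A‖² + ⟨∂*A,R∂*A⟩`, `R` the projection onto `ΔN(Q′_j)`, `∂∂λ = 0`, `Q_j∂λ = 0`, `∂*∂λ = Δλ`,
Δ injective on `N(Q′_j)`), positivity of the form on `{Q_jA = 0}` (`γ > 0`), the δ-gauge operator `H_j^{δ}` of [4] Sect. D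
(`Q_jH_j^{δ}B = Q_jH_jB`, `R∂*H_j^{δ}B = 0`, `∂H_j^{δ}B ⊥ ∂{Q_j· = 0, R∂*· = 0}`) and `⟨B,Δ_jB⟩ := ‖∂H_j^{δ}B‖²` ([4] (1.65)).
[cite: Balaban1984PropagatorsII, (2.119) p.243] -/
theorem eq2119_fp (μ : Measure N) [μ.IsAddLeftInvariant] (ι : N →ₗ[ℝ] A) (M Gt : A →ₗ[ℝ] A)
    (Tt : A →ₗ[ℝ] N) (Q : A →ₗ[ℝ] W) (Hj : Bs →ₗ[ℝ] A) (Hjs : A →ₗ[ℝ] Bs) (Δj : Bs →ₗ[ℝ] Bs)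
    (hM : ∀ x y : A, ⟪M x, y⟫_ℝ = ⟪x, M y⟫_ℝ) (hι : ∀ n, Q (ι n) = 0)
    (hcrit : ∀ (b : Bs) (v : A), Q v = 0 → ⟪v, M (Hj b)⟫_ℝ = 0)
    (hGt : ∀ J, Gt J = ι (Tt J)) (hsol : ∀ (n : N) (J : A), ⟪ι n, M (Gt J)⟫_ℝ = ⟪ι n, J⟫_ℝ)
    (hadj : ∀ (b : Bs) (x : A), ⟪Hj b, x⟫_ℝ = ⟪b, Hjs x⟫_ℝ)
    -- the data replacing `h2118`:
    (curl : A →ₗ[ℝ] T) (dstar : A →ₗ[ℝ] Vs) (Rp : Vs →ₗ[ℝ] Vs) (D : Ng →ₗ[ℝ] Vs) (dN : Ng →ₗ[ℝ] A)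
    (K : Submodule ℝ Vs) [K.HasOrthogonalProjection] (hK : LinearMap.range D = K)
    (hR : ∀ g, Rp g = K.starProjection g)
    (hformM : ∀ v, ⟪v, M v⟫_ℝ = ‖curl v‖ ^ 2 + ⟪dstar v, Rp (dstar v)⟫_ℝ)
    (hcurl : ∀ l, curl (dN l) = 0) (hQ : ∀ l, Q (dN l) = 0) (hD : ∀ l, dstar (dN l) = D l)
    (hDinj : Function.Injective D) {γ : ℝ} (hγ : 0 < γ)
    (hpos : ∀ v : A, Q v = 0 → γ * ‖v‖ ^ 2 ≤ ⟪v, M v⟫_ℝ)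
    (Hδ : Bs →ₗ[ℝ] A) (hQH : ∀ b, Q (Hδ b) = Q (Hj b)) (hδR : ∀ b, Rp (dstar (Hδ b)) = 0)
    (hcritδ : ∀ (b : Bs) (v : A), Q v = 0 → Rp (dstar v) = 0 → ⟪curl v, curl (Hδ b)⟫_ℝ = 0)
    (h165 : ∀ b, ⟪b, Δj b⟫_ℝ = ‖curl (Hδ b)‖ ^ 2)
    -- the rest as in `eq2119`:
    (ν : Measure NB) (ιB : NB → Bs) (Qpp : Bs →ₗ[ℝ] V) (a : V →ₗ[ℝ] V) (K₁ K₂ : A →ₗ[ℝ] A) (J : A) (E c : ℝ)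
    (h2112 : E = Real.exp ((1 / 2) * ⟪J, K₁ J⟫_ℝ) * c *
      ∫ m, Real.exp (-(1 / 2) * ⟪Qpp (ιB m), a (Qpp (ιB m))⟫_ℝ) *
        (∫ n, Real.exp (-(1 / 2) * ⟪ι n + Hj (ιB m), M (ι n + Hj (ιB m))⟫_ℝ + ⟪ι n + Hj (ιB m), J - K₂ J⟫_ℝ) ∂μ) ∂ν) :
    E = Real.exp ((1 / 2) * ⟪J, K₁ J⟫_ℝ + (1 / 2) * ⟪J - K₂ J, Gt (J - K₂ J)⟫_ℝ) *
        (c * ∫ n, Real.exp (-(1 / 2) * ⟪ι n, M (ι n)⟫_ℝ) ∂μ) *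
      ∫ m, Real.exp (-(1 / 2) * ⟪Qpp (ιB m), a (Qpp (ιB m))⟫_ℝ - (1 / 2) * ⟪ιB m, Δj (ιB m)⟫_ℝ
          + ⟪ιB m, Hjs (J - K₂ J)⟫_ℝ) ∂ν :=
  B6GaussianIdentity2119.eq2119 μ ι M Gt Tt Q Hj Hjs Δj hM hι hcrit hGt hsol hadj
    (h2118_of_pos Q M curl dstar Rp D dN K hK hR hM hformM hcurl hQ hD hDinj hγ hpos Hj Hδ Δj hQH hcrit hδR
      hcritδ h165)
    ν ιB Qpp a K₁ K₂ J E c h2112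

omit [MeasurableSpace NB] in
/-- **(2.129) p. 246 with THE printed operators (2.130)–(2.131), from (2.112), with (2.116)–(2.118) PROVED rather than
assumed:** `…B6Repr2129.eq2129_printed` verbatim, its hypothesis `h2118` replaced by the printed structure + positivity +
the δ-gauge operator `H_j^{δ}` of [4] Sect. D (`Q_jH_j^{δ}B = B`) and `⟨B,Δ_jB⟩ := ‖∂H_j^{δ}B‖²` ([4] (1.65)); `Δ_j`
symmetric as there. [cite: Balaban1984PropagatorsII, (2.129)–(2.130) p.246] -/
theorem eq2129_printed_fp [MeasurableSpace NB] [AddCommGroup NB] [Module ℝ NB] [MeasurableAdd NB]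
    (μ : Measure N) [μ.IsAddLeftInvariant] (ι : N →ₗ[ℝ] A) (Tt : A →ₗ[ℝ] N)
    (M Gj : A →ₗ[ℝ] A) (Q : A →ₗ[ℝ] W) (Qs : W →ₗ[ℝ] A) (a₁ E : W →ₗ[ℝ] W) (Hjs : A →ₗ[ℝ] W)
    (Δj : W →ₗ[ℝ] W)
    (hM : ∀ x y : A, ⟪M x, y⟫_ℝ = ⟪x, M y⟫_ℝ) (hQs : ∀ (w : W) (v : A), ⟪Qs w, v⟫_ℝ = ⟪w, Q v⟫_ℝ)
    (hGj : (M + Qs ∘ₗ a₁ ∘ₗ Q) ∘ₗ Gj = LinearMap.id) (hE : (Q ∘ₗ Gj ∘ₗ Qs) ∘ₗ E = LinearMap.id)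
    (hι : ∀ n, Q (ι n) = 0) (hT : ∀ J, B6SectA.tildeOp Gj Q Qs E J = ι (Tt J))
    (hadj : ∀ (b : W) (x : A), ⟪B6SectA.hOp Gj Qs E b, x⟫_ℝ = ⟪b, Hjs x⟫_ℝ)
    -- the data replacing `h2118`:
    (curl : A →ₗ[ℝ] T) (dstar : A →ₗ[ℝ] Vs) (Rp : Vs →ₗ[ℝ] Vs) (D : Ng →ₗ[ℝ] Vs) (dN : Ng →ₗ[ℝ] A)
    (K : Submodule ℝ Vs) [K.HasOrthogonalProjection] (hK : LinearMap.range D = K)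
    (hR : ∀ g, Rp g = K.starProjection g)
    (hformM : ∀ v, ⟪v, M v⟫_ℝ = ‖curl v‖ ^ 2 + ⟪dstar v, Rp (dstar v)⟫_ℝ)
    (hcurl : ∀ l, curl (dN l) = 0) (hQ : ∀ l, Q (dN l) = 0) (hD : ∀ l, dstar (dN l) = D l)
    (hDinj : Function.Injective D) {γ : ℝ} (hγ : 0 < γ)
    (hpos : ∀ v : A, Q v = 0 → γ * ‖v‖ ^ 2 ≤ ⟪v, M v⟫_ℝ)
    (Hδ : W →ₗ[ℝ] A) (hQH : ∀ b, Q (Hδ b) = b) (hδR : ∀ b, Rp (dstar (Hδ b)) = 0)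
    (hcritδ : ∀ (b : W) (v : A), Q v = 0 → Rp (dstar v) = 0 → ⟪curl v, curl (Hδ b)⟫_ℝ = 0)
    (h165 : ∀ b, ⟪b, Δj b⟫_ℝ = ‖curl (Hδ b)‖ ^ 2)
    -- the rest as in `eq2129_printed`:
    (ν : Measure NB) [ν.IsAddLeftInvariant] (ιB : NB →ₗ[ℝ] W) (TB : W →ₗ[ℝ] NB)
    (Qpp : W →ₗ[ℝ] V) (Qpps : V →ₗ[ℝ] W) (a : V →ₗ[ℝ] V) (Ct : W →ₗ[ℝ] W)
    (hQpp : ∀ (w : V) (b : W), ⟪Qpps w, b⟫_ℝ = ⟪w, Qpp b⟫_ℝ) (ha : ∀ x y : V, ⟪a x, y⟫_ℝ = ⟪x, a y⟫_ℝ)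
    (hΔj : ∀ x y : W, ⟪Δj x, y⟫_ℝ = ⟪x, Δj y⟫_ℝ) (hCt : ∀ K, Ct K = ιB (TB K))
    (hCsol : ∀ (m : NB) (K : W), ⟪ιB m, (Qpps ∘ₗ a ∘ₗ Qpp + Δj) (Ct K)⟫_ℝ = ⟪ιB m, K⟫_ℝ)
    (G K₁ K₂ : A →ₗ[ℝ] A) (c : ℝ)
    (h2112 : ∀ J : A, Real.exp ((1 / 2) * ⟪J, G J⟫_ℝ) = Real.exp ((1 / 2) * ⟪J, K₁ J⟫_ℝ) * c *
      ∫ m, Real.exp (-(1 / 2) * ⟪Qpp (ιB m), a (Qpp (ιB m))⟫_ℝ) *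
        (∫ n, Real.exp (-(1 / 2) * ⟪ι n + B6SectA.hOp Gj Qs E (ιB m), M (ι n + B6SectA.hOp Gj Qs E (ιB m))⟫_ℝ
          + ⟪ι n + B6SectA.hOp Gj Qs E (ιB m), J - K₂ J⟫_ℝ) ∂μ) ∂ν)
    (J : A) :
    ⟪J, G J⟫_ℝ = ⟪J, K₁ J⟫_ℝ + ⟪J - K₂ J,
      (B6SectA.tildeOp Gj Q Qs E + B6SectA.hOp Gj Qs E ∘ₗ Ct ∘ₗ Hjs) (J - K₂ J)⟫_ℝ :=
  B6Repr2129.eq2129_printed μ ι Tt M Gj Q Qs a₁ E Hjs Δj hM hQs hGj hE hι hT hadj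
    (fun b => by
      rw [h165]
      exact hOp_form_eq Q M Gj Qs a₁ E curl dstar Rp D dN K hK hR hM hQs hGj hE hformM hcurl hQ hD hDinj hγ hpos b
        (hQH b) (hδR b) (hcritδ b))
    ν ιB TB Qpp Qpps a Ct hQpp ha hΔj hCt hCsol G K₁ K₂ c h2112 J

end Assembled

end Literature.MathematicalPhysics.QuantumFieldTheory.Balaban1983to89.B6Eq2129FaddeevPopov

end
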